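import Mathlib
import Literature.NumberTheory.Irrationality.Lai2025TwoAdic.GeneralTwoAdicValuationA
import Literature.NumberTheory.Irrationality.Lai2025TwoAdic.PhiLowerBound
import Literature.NumberTheory.Irrationality.PAdicZetaValues.Criterion
import Literature.NumberTheory.Irrationality.PAdicZetaValues.Hurwitz
import Literature.NumberTheory.Irrationality.PAdicZetaValues.HurwitzLemma27TwoProofs
import Literature.NumberTheory.Irrationality.PAdicZetaValues.Records
import Literature.NumberTheory.Transcendental.ZetaLinearFormsCriterion
import HarnessLib

/-!
# Lai 2025 (IJNT), Theorem 1.2 (general `s`, both parities) and Theorem 1.1 — PROVED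
# (discharge of the named facts `PAdicZetaValues.lai2025TwoAdic_theorem12` and `PAdicZetaValues.lai2025TwoAdic_theorem11`)

Topic `Literature/NumberTheory/Irrationality/Lai2025TwoAdic`.  Source: L. Lai, *On the irrationality of certain `2`-adic
zeta values*, Int. J. Number Theory (2025) = arXiv:2304.00816 [Lai2025TwoAdicZeta], Theorems 1.1, 1.2 (§1) and §7 (their
proofs) (held text `paper:arxiv-2304.00816`, chunks p0003, p0013, read on the page).  PROOF FILE (theorems + three plumbing
definitions with bodies; no named fact; net debt −2).  Last file of the general-`s` discharge for the `A_n` family;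
inputs: `GeneralLinearFormsS.lean` (Lemma 3.3: `Ss_eq`, `rhoI_eq_zero_of_odd`; Lemma 5.2: `abs_rhoZero_le`, `abs_rhoI_le`),
`PhiRefinement.lean` (Lemmas 4.3–4.6 with `Φ_n`: `exists_int_phi_rhoZero`, `exists_int_phi_rhoI'`),
`GeneralTwoAdicValuationA.lean` (Lemma 6.2: `Ss_mersenne_ne_zero`, `norm_Ss_mersenne_le`), `PhiLowerBound.lean`
(Lemma 5.1, lower half: `eventually_exp_mul_le_PhiL_pow`), the tree's Lemma 2.1
(`PAdicZetaValues.exists_isIrrational_of_linearForms`), Lemma 2.7 for `p = 2`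
(`PAdicZetaValues.lai2025TwoAdic_lemma27_two_holds`) and the prime number theorem bound
(`Transcendental.eventually_lcmUpto_mul_pow_le_exp`: `d_n^k ≤ e^{(k+ε)n}`).

## Source, as printed ([Lai2025TwoAdicZeta, Thms 1.1, 1.2 and §7])

**Theorem 1.1.** «For every nonnegative integer `s`, the following set contains at least one irrational number:
`{ζ₂(j) | j ∈ ℤ ∩ [s+3, 3s+5], j odd}`.  In particular, at least one of the four `2`-adic numbers `ζ₂(7), ζ₂(9), ζ₂(11),
ζ₂(13)` is irrational.»

**Theorem 1.2.** «For any nonnegative integer `s` and any `δ ∈ {0,1}`, the following set contains at least one irrational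
number: `{ζ₂(j, 1/4) | j ∈ ℤ ∩ [s+3, 3s+5], j ≡ δ (mod 2)}`.»

*Proof of Theorem 1.2 (§7).* «Combining Lemma 3.3, Lemma 4.5 and Lemma 4.6, we obtain that: `Φ_n^{−s−2}d_n^{3s+5}S_n` is a
linear combination of `1`, `ζ₂(j,1/4)` (`s+3 ≤ j ≤ 3s+5` and `j ≡ s+1+δ (mod 2)`) with integer coefficients.  By (d_n_est),
Lemma 5.1, Lemma 5.2 and Lemma 6.2, when `n = 2^m − 1 → ∞` we have
`max_{0 ≤ i ≤ 2s+4} |Φ_n^{−s−2}d_n^{3s+5}ρ_{n,i}| · |Φ_n^{−s−2}d_n^{3s+5}S_n|₂ ≤ exp(((4 − 6 log 2)s + 7 − 12 log 2 + o(1))n) → 0`,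
(because `4 − 6 log 2 < 0` and `7 − 12 log 2 < 0`) and importantly `Φ_n^{−s−2}d_n^{3s+5}S_n ≠ 0`.  Applying Lemma 2.1 to the
sequence of linear forms `{Φ_n^{−s−2}d_n^{3s+5}S_n}_{n = 2^m−1, m ≥ 2}`, we deduce that the following set contains at least one
irrational number: `{ζ₂(j, ¼) | j ∈ ℤ ∩ [s+3, 3s+5], j ≡ s+1+δ (mod 2)}`.  This is true for any nonnegative integer `s` and
any `δ ∈ {0,1}`.  The proof of Theorem 1.2 is complete.»

*Proof of Theorem 1.1 (§7).* «By Lemma 2.7, Theorem 1.1 is the special case `δ = 1` of Theorem 1.2.»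

## What is formalised (all PROVED) and the one deviation

* `parIdx s δ` = the indices `i ∈ [2, 2s+4]` with `i ≡ δ (mod 2)` (the other `ρ_{n,i}` vanish, `rhoI_eq_zero_of_odd`);
  `xiVecA s δ` = the vector `(1, ζ₂(i+s+1,¼))_{i ∈ parIdx}` (so `j = i+s+1 ≡ s+1+δ`), `coefVecA s δ n` = the coefficients
  `Φ_n^{−s−2}d_n^{3s+5}ρ_{n,0}`, `Φ_n^{−s−2}d_n^{3s+5}ρ_{n,i}`; `linearFormA_eq` (the form `= Φ_n^{−s−2}d_n^{3s+5}S_n`),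
  `exists_int_coefVecA` (integrality, Lemmas 4.5–4.6 with `Φ_n`), `abs_coefVecA_le` (Lemma 5.2),
  `norm_linearFormA_mersenne_le` and `linearFormA_mersenne_ne_zero` (Lemma 6.2 along `n = 2^m − 1`, `m ≥ 2`).
* `tendsto_boundFunA` — the displayed estimate `→ 0` along `n = 2^m − 1`.  DEVIATION (weaker but sufficient constant): in
  place of the full rate `Φ_n = e^{(2 log 2 − 1 + o(1))n}` of Lemma 5.1 we use its proved lower half `Φ_n ≥ e^{n/4}`
  (`PhiLowerBound.lean`), the PNT bound `d_n^{3s+5} ≤ e^{(3s+5+¼)n}` and `2^{(2s+3)m} = (n+1)^{2s+3}`; the exponent is then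
  `(2.75 s + 4.75 − (4s+8) log 2)n ≤ −n/2` because `log 2 > 11/16` (Mathlib's `Real.log_two_gt_d9`), and
  `K_ρ(s)(n+1)^{4s+9}e^{−n/2} → 0`.
* **Theorem 1.2**: `exists_isIrrational_parity_window` and the discharge `PAdicZetaValues.lai2025TwoAdic_theorem12_holds`.
* **Theorem 1.1**: `PAdicZetaValues.lai2025TwoAdic_theorem11_holds` (`δ` chosen so that `j` is odd; `ζ₂(j) = ½ζ₂(j,¼)` by
  Lemma 2.7, and a nonzero rational multiple of an irrational is irrational), and its printed instance `s = 3`: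
  `PAdicZetaValues.exists_isIrrational_padicZetaValue_two_seven_to_thirteen` (one of `ζ₂(7), ζ₂(9), ζ₂(11), ζ₂(13)`).

Cell zeta5-irr / pub-zeta5 (HONEST FRAMING: systematic search; no irrationality claim unless kernel-certified): this is a
kernel-checked proof of PUBLISHED `2`-adic irrationality theorems [Lai2025TwoAdicZeta, Thms 1.1, 1.2]; nothing here bears
on `ζ(5) ∈ ℝ`.
-/

noncomputable section

open Finset Filter Topology
open Literature.NumberTheory.LocalFields
open Literature.NumberTheory.Irrationality.PAdicZetaValues
open Literature.NumberTheory.Transcendental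
open scoped Nat

namespace Literature.NumberTheory.Irrationality.Lai2025TwoAdic

/-! ## §1. The integer linear forms `Φ_n^{−s−2}d_n^{3s+5}S_n = Σ coefficients × (1, ζ₂(i+s+1,¼))` -/

/-- The indices `i ∈ [2, 2s+4]` with `i ≡ δ (mod 2)` («`s+3 ≤ j ≤ 3s+5` and `j ≡ s+1+δ (mod 2)`», `j = i+s+1`).
[cite: Lai2025TwoAdicZeta, §7 (proof of Thm 1.2) with Lemma 3.3 ("ρ_{n,i} = 0 when i ≢ δ")] -/
def parIdx (s δ : ℕ) : Finset ℕ := (Icc 2 (2 * s + 4)).filter fun i => (i + δ) % 2 = 0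

/-- Membership in `parIdx`. [cite: Lai2025TwoAdicZeta, §7 (proof of Thm 1.2)] -/
theorem mem_parIdx {s δ i : ℕ} : i ∈ parIdx s δ ↔ (2 ≤ i ∧ i ≤ 2 * s + 4) ∧ (i + δ) % 2 = 0 := by
  rw [parIdx, mem_filter, mem_Icc]

/-- `parIdx s δ ⊆ [2, 2s+4]`. [cite: Lai2025TwoAdicZeta, §7 (proof of Thm 1.2)] -/
theorem parIdx_subset (s δ : ℕ) : parIdx s δ ⊆ Icc 2 (2 * s + 4) := filter_subset _ _

/-- The vector `(1, ζ₂(i+s+1, ¼))_{i ∈ parIdx}` of Theorem 1.2 / Lemma 2.1, indexed by `Option parIdx` (`none ↦ 1`).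
[cite: Lai2025TwoAdicZeta, §7 (proof of Thm 1.2: "a linear combination of 1, ζ₂(j,1/4) …")] -/
def xiVecA (s δ : ℕ) : Option (parIdx s δ) → ℚ_[2]
  | none => 1
  | some i => padicHurwitzZeta 2 ((i : ℕ) + s + 1) (4 : ℚ_[2])⁻¹

/-- The coefficients `Φ_n^{−s−2}d_n^{3s+5}ρ_{n,0}` (`none`) and `Φ_n^{−s−2}d_n^{3s+5}ρ_{n,i}` (`some i`).
[cite: Lai2025TwoAdicZeta, §7 (proof of Thm 1.2, the linear forms Φ_n^{−s−2}d_n^{3s+5}S_n)] -/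
def coefVecA (s δ n : ℕ) : Option (parIdx s δ) → ℚ
  | none => (Nat.lcmUpto n : ℚ) ^ (3 * s + 5) * rhoZero s δ n / (PhiL n : ℚ) ^ (s + 2)
  | some i => (Nat.lcmUpto n : ℚ) ^ (3 * s + 5) * rhoI s δ n i / (PhiL n : ℚ) ^ (s + 2)

/-- **The linear form** (Lemma 3.3 times `Φ_n^{−s−2}d_n^{3s+5}`, the `ρ_{n,i}` with `i ≢ δ` dropped since they vanish):
`Σ_o coef_o · ξ_o = Φ_n^{−s−2}d_n^{3s+5}·S_n` in `ℚ₂` (`δ ≤ 1`).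
[cite: Lai2025TwoAdicZeta, §7 (proof of Thm 1.2) with Lemma 3.3] -/
theorem linearFormA_eq (s : ℕ) {δ : ℕ} (hδ : δ ≤ 1) (n : ℕ) :
    ∑ o, ((coefVecA s δ n o : ℚ) : ℚ_[2]) * xiVecA s δ o =
      ((((Nat.lcmUpto n : ℚ) ^ (3 * s + 5) / (PhiL n : ℚ) ^ (s + 2) : ℚ)) : ℚ_[2]) * Ss s δ n := by
  classical
  rw [Fintype.sum_option]
  simp only [coefVecA, xiVecA, mul_one]
  rw [Finset.sum_coe_sort (parIdx s δ) (fun i : ℕ =>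
    ((((Nat.lcmUpto n : ℚ) ^ (3 * s + 5) * rhoI s δ n i / (PhiL n : ℚ) ^ (s + 2) : ℚ)) : ℚ_[2]) *
      padicHurwitzZeta 2 (i + s + 1) (4 : ℚ_[2])⁻¹)]
  have hvan : ∀ i ∈ Icc 2 (2 * s + 4), i ∉ parIdx s δ →
      ((((Nat.lcmUpto n : ℚ) ^ (3 * s + 5) * rhoI s δ n i / (PhiL n : ℚ) ^ (s + 2) : ℚ)) : ℚ_[2]) *
        padicHurwitzZeta 2 (i + s + 1) (4 : ℚ_[2])⁻¹ = 0 := by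
    intro i hi hni
    have hi' := mem_Icc.1 hi
    rw [mem_parIdx] at hni
    have hodd : Odd (i + δ) := by rw [Nat.odd_iff]; omega
    rw [rhoI_eq_zero_of_odd s hδ n (by omega) hi'.2 hodd]
    simp
  rw [sum_subset (parIdx_subset s δ) hvan, Ss_eq s hδ n]
  push_cast
  rw [mul_add, mul_sum]
  congr 1
  · ring
  · exact sum_congr rfl fun i _ => by ring

/-- **Integrality** (Lemmas 4.5, 4.6 with `Φ_n`): every coefficient `Φ_n^{−s−2}d_n^{3s+5}ρ_{n,i}` is an integer (`δ ≤ 1`).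
[cite: Lai2025TwoAdicZeta, §7 (proof of Thm 1.2: "with integer coefficients"), Lemmas 4.5–4.6] -/
theorem exists_int_coefVecA (s : ℕ) {δ : ℕ} (hδ : δ ≤ 1) (n : ℕ) (o : Option (parIdx s δ)) :
    ∃ z : ℤ, coefVecA s δ n o = z := by
  cases o with
  | none => exact exists_int_phi_rhoZero s hδ n
  | some i => exact exists_int_phi_rhoI' s δ n i

/-- **The Archimedean sizes** (Lemma 5.2 times `Φ_n^{−s−2}d_n^{3s+5}`):
`|Φ_n^{−s−2}d_n^{3s+5}ρ_{n,i}| ≤ Φ_n^{−s−2}d_n^{3s+5}·K_ρ(s)(n+1)^{2s+6}2^{(6s+12)n}` (in `ℝ`).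
[cite: Lai2025TwoAdicZeta, §7 (proof of Thm 1.2) with Lemma 5.2 (rho_est)] -/
theorem abs_coefVecA_le (s : ℕ) {δ : ℕ} (hδ : δ ≤ 1) (n : ℕ) (o : Option (parIdx s δ)) :
    |((coefVecA s δ n o : ℚ) : ℝ)| ≤
      (Nat.lcmUpto n : ℝ) ^ (3 * s + 5) / (PhiL n : ℝ) ^ (s + 2) *
        ((Krho s : ℝ) * ((n : ℝ) + 1) ^ (2 * s + 6) * (2 : ℝ) ^ ((6 * s + 12) * n)) := by
  have hq : |coefVecA s δ n o| ≤
      (Nat.lcmUpto n : ℚ) ^ (3 * s + 5) / (PhiL n : ℚ) ^ (s + 2) *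
        (Krho s * ((n : ℚ) + 1) ^ (2 * s + 6) * (2 : ℚ) ^ ((6 * s + 12) * n)) := by
    have hd : (0 : ℚ) ≤ (Nat.lcmUpto n : ℚ) ^ (3 * s + 5) := by positivity
    have hP : (0 : ℚ) < (PhiL n : ℚ) ^ (s + 2) := by have := PhiL_pos n; positivity
    have key : ∀ r B : ℚ, |r| ≤ B →
        |(Nat.lcmUpto n : ℚ) ^ (3 * s + 5) * r / (PhiL n : ℚ) ^ (s + 2)| ≤
          (Nat.lcmUpto n : ℚ) ^ (3 * s + 5) / (PhiL n : ℚ) ^ (s + 2) * B := by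
      intro r B h
      rw [abs_div, abs_mul, abs_of_nonneg hd, abs_of_pos hP, mul_div_right_comm]
      exact mul_le_mul_of_nonneg_left h (by positivity)
    cases o with
    | none => exact key _ _ (abs_rhoZero_le s hδ n)
    | some i =>
      refine key _ _ (abs_rhoI_le s hδ n ?_)
      have := mem_parIdx.1 i.2
      rw [mem_Icc]; omega
  have h := (Rat.cast_le (K := ℝ)).2 hq
  rw [Rat.cast_abs] at h
  refine h.trans (le_of_eq ?_)
  push_cast; ring

/-- `Φ_n` is odd («Obviously `v₂(Φ_n) = 0`»). [cite: Lai2025TwoAdicZeta, Lemma 6.2 (proof)] -/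
theorem two_not_dvd_PhiL (n : ℕ) : ¬ 2 ∣ PhiL n := by
  have h := padicValNat_two_PhiL n
  rw [padicValNat.eq_zero_iff] at h
  rcases h with h | h | h
  · norm_num at h
  · exact absurd h (PhiL_pos n).ne'
  · exact h

/-- **The `2`-adic size** along `n = 2^m − 1` (`m ≥ 2`): `‖Φ_n^{−s−2}d_n^{3s+5}S_n‖₂ ≤ ‖S_n‖₂ ≤ 2^{(2s+3)m − (10s+20)n − 5s − 8}`
(`Φ_n` odd, `d_n` an integer). [cite: Lai2025TwoAdicZeta, §7 (proof of Thm 1.2) with Lemma 6.2] -/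
theorem norm_linearFormA_mersenne_le (s : ℕ) {δ : ℕ} (hδ : δ ≤ 1) {m : ℕ} (hm : 2 ≤ m) :
    ‖∑ o, ((coefVecA s δ (2 ^ m - 1) o : ℚ) : ℚ_[2]) * xiVecA s δ o‖ ≤
      (2 : ℝ) ^ ((2 * s + 3) * (m : ℤ) - (10 * s + 20) * ((2 ^ m - 1 : ℕ) : ℤ) - 5 * s - 8) := by
  rw [linearFormA_eq s hδ, norm_mul]
  have hc : ‖((((Nat.lcmUpto (2 ^ m - 1) : ℚ) ^ (3 * s + 5) / (PhiL (2 ^ m - 1) : ℚ) ^ (s + 2) : ℚ)) : ℚ_[2])‖ ≤ 1 := by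
    push_cast
    rw [norm_div, norm_pow, norm_pow, norm_natCast_of_not_dvd (p := 2) (two_not_dvd_PhiL _), one_pow, div_one]
    have := Padic.norm_int_le_one (p := 2) (Nat.lcmUpto (2 ^ m - 1) : ℤ)
    push_cast at this
    exact pow_le_one₀ (norm_nonneg _) this
  calc ‖((((Nat.lcmUpto (2 ^ m - 1) : ℚ) ^ (3 * s + 5) / (PhiL (2 ^ m - 1) : ℚ) ^ (s + 2) : ℚ)) : ℚ_[2])‖ *
        ‖Ss s δ (2 ^ m - 1)‖
      ≤ 1 * (2 : ℝ) ^ ((2 * s + 3) * (m : ℤ) - (10 * s + 20) * ((2 ^ m - 1 : ℕ) : ℤ) - 5 * s - 8) :=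
        mul_le_mul hc (norm_Ss_mersenne_le s hδ hm) (norm_nonneg _) zero_le_one
    _ = _ := one_mul _

/-- **Non-vanishing** along `n = 2^m − 1` (`m ≥ 2`) («and importantly `Φ_n^{−s−2}d_n^{3s+5}S_n ≠ 0`»).
[cite: Lai2025TwoAdicZeta, §7 (proof of Thm 1.2) with Lemma 6.2] -/
theorem linearFormA_mersenne_ne_zero (s : ℕ) {δ : ℕ} (hδ : δ ≤ 1) {m : ℕ} (hm : 2 ≤ m) :
    ∑ o, ((coefVecA s δ (2 ^ m - 1) o : ℚ) : ℚ_[2]) * xiVecA s δ o ≠ 0 := by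
  rw [linearFormA_eq s hδ]
  refine mul_ne_zero ?_ (Ss_mersenne_ne_zero s hδ hm)
  have hd : (Nat.lcmUpto (2 ^ m - 1) : ℚ) ≠ 0 := by exact_mod_cast (Nat.lcmUpto_pos (2 ^ m - 1)).ne'
  have hP : (PhiL (2 ^ m - 1) : ℚ) ≠ 0 := PhiL_cast_ne_zero _
  exact_mod_cast div_ne_zero (pow_ne_zero _ hd) (pow_ne_zero _ hP)

/-! ## §2. The sizes multiply to `o(1)` along `n = 2^m − 1` -/

/-- `n_m := 2^m − 1 → ∞`. [folklore] -/
private theorem tendsto_mersenne : Tendsto (fun m : ℕ => 2 ^ m - 1) atTop atTop := by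
  refine tendsto_atTop_mono (fun m => ?_) tendsto_id
  have : m < 2 ^ m := Nat.lt_two_pow_self
  show m ≤ 2 ^ m - 1
  omega

/-- `K_ρ(s) ≥ 0` in `ℝ`. [cite: Lai2025TwoAdicZeta, Lemma 5.2] -/
theorem Krho_cast_nonneg (s : ℕ) : (0 : ℝ) ≤ (Krho s : ℝ) := by
  exact_mod_cast (zero_le_one.trans (one_le_Krho s))

/-- `K_ρ(s)(n+1)^{4s+9}e^{−n/2} → 0`. [cite: Lai2025TwoAdicZeta, §7 (proof of Thm 1.2: "→ 0 as n = 2^m−1 → ∞")] -/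
theorem tendsto_poly_expA (s : ℕ) :
    Tendsto (fun n : ℕ => (Krho s : ℝ) * ((n : ℝ) + 1) ^ (4 * s + 9) * Real.exp (-(n : ℝ) / 2)) atTop (𝓝 0) := by
  have hx : Tendsto (fun n : ℕ => ((n : ℝ) + 1) / 2) atTop atTop :=
    (tendsto_atTop_add_const_right atTop (1 : ℝ) tendsto_natCast_atTop_atTop).atTop_div_const (by norm_num)
  have h := (Real.tendsto_pow_mul_exp_neg_atTop_nhds_zero (4 * s + 9)).comp hx
  have h' := h.const_mul ((Krho s : ℝ) * 2 ^ (4 * s + 9) * Real.exp (1 / 2))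
  rw [mul_zero] at h'
  refine h'.congr fun n => ?_
  simp only [Function.comp_def]
  rw [div_pow, show Real.exp (-(n : ℝ) / 2) = Real.exp (1 / 2) * Real.exp (-(((n : ℝ) + 1) / 2)) by
    rw [← Real.exp_add]; congr 1; ring]
  field_simp

/-- The exponential comparison «because `4 − 6 log 2 < 0` and `7 − 12 log 2 < 0`», in the weaker form used here
(`Φ_n ≥ e^{n/4}` instead of `e^{(2log2−1+o(1))n}`): `e^{(3s+5+¼)n}·e^{−(s+2)n/4}·2^{(6s+12)n}·2^{−(10s+20)n} ≤ e^{−n/2}`,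
i.e. `2.75 s + 5.25 ≤ (4s+8) log 2`, true since `log 2 > 11/16`. [cite: Lai2025TwoAdicZeta, §7 (proof of Thm 1.2)] -/
theorem exp_mul_two_pow_leA (s n : ℕ) :
    Real.exp ((3 * s + 5 + 1 / 4) * n) * Real.exp (-(((s + 2 : ℕ) : ℝ) * n / 4)) *
        (2 : ℝ) ^ ((6 * s + 12) * n) * (2 : ℝ) ^ (-(((10 * s + 20) * n : ℕ) : ℤ)) ≤ Real.exp (-(n : ℝ) / 2) := by
  have hlog := Real.log_two_gt_d9
  have hn : (0 : ℝ) ≤ n := Nat.cast_nonneg n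
  have hs : (0 : ℝ) ≤ s := Nat.cast_nonneg s
  have h1 : (2 : ℝ) ^ ((6 * s + 12) * n) = Real.exp (((6 * s + 12) * n : ℕ) * Real.log 2) := by
    rw [← Real.exp_log (by positivity : (0 : ℝ) < 2 ^ ((6 * s + 12) * n)), Real.log_pow]
  have h2 : (2 : ℝ) ^ (-(((10 * s + 20) * n : ℕ) : ℤ)) = Real.exp (-(((10 * s + 20) * n : ℕ) * Real.log 2)) := by
    rw [zpow_neg, zpow_natCast, ← Real.exp_log (by positivity : (0 : ℝ) < 2 ^ ((10 * s + 20) * n)), Real.log_pow,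
      ← Real.exp_neg]
  rw [h1, h2, ← Real.exp_add, ← Real.exp_add, ← Real.exp_add]
  refine Real.exp_le_exp.2 ?_
  push_cast
  have h16 : (11 : ℝ) / 16 ≤ Real.log 2 := by linarith
  nlinarith [mul_nonneg hn (sub_nonneg.2 h16), mul_nonneg (mul_nonneg hn hs) (sub_nonneg.2 h16)]

/-- The bound function along `n = 2^m − 1`:
`(d_n^{3s+5}/Φ_n^{s+2})·K_ρ(s)(n+1)^{2s+6}2^{(6s+12)n} · 2^{(2s+3)m − (10s+20)n − 5s − 8}`.
[cite: Lai2025TwoAdicZeta, §7 (proof of Thm 1.2, the displayed estimate)] -/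
def boundFunA (s m : ℕ) : ℝ :=
  (Nat.lcmUpto (2 ^ m - 1) : ℝ) ^ (3 * s + 5) / (PhiL (2 ^ m - 1) : ℝ) ^ (s + 2) *
    ((Krho s : ℝ) * (((2 ^ m - 1 : ℕ) : ℝ) + 1) ^ (2 * s + 6) * (2 : ℝ) ^ ((6 * s + 12) * (2 ^ m - 1))) *
    (2 : ℝ) ^ ((2 * s + 3) * (m : ℤ) - (10 * s + 20) * ((2 ^ m - 1 : ℕ) : ℤ) - 5 * s - 8)

/-- `boundFunA s m ≥ 0`. [cite: Lai2025TwoAdicZeta, §7 (proof of Thm 1.2)] -/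
theorem boundFunA_nonneg (s m : ℕ) : 0 ≤ boundFunA s m := by
  unfold boundFunA
  have := Krho_cast_nonneg s
  exact mul_nonneg (mul_nonneg (by positivity) (mul_nonneg (mul_nonneg this (by positivity)) (by positivity)))
    (by positivity)

/-- **The sizes multiply to `o(1)`**: `boundFunA s m → 0` (PNT `d_n^{3s+5} ≤ e^{(3s+5+¼)n}`, `Φ_n^{s+2} ≥ e^{(s+2)n/4}`,
`2^{(2s+3)m} = (n+1)^{2s+3}`, then `exp_mul_two_pow_leA` and `tendsto_poly_expA`).
[cite: Lai2025TwoAdicZeta, §7 (proof of Thm 1.2, the displayed estimate "→ 0")] -/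
theorem tendsto_boundFunA (s : ℕ) : Tendsto (boundFunA s) atTop (𝓝 0) := by
  -- PNT: `d_n^{3s+5} ≤ e^{(3s+5+¼)n}` for large `n`
  have hpnt : ∀ᶠ n : ℕ in atTop, (Nat.lcmUpto n : ℝ) ^ (3 * s + 5) ≤ Real.exp ((3 * s + 5 + 1 / 4) * n) := by
    have h := eventually_lcmUpto_mul_pow_le_exp 1 (3 * s + 5) (ε := 1 / 4) (by norm_num)
    filter_upwards [h] with n hn
    rw [one_mul] at hn
    refine hn.trans (le_of_eq ?_)
    congr 1; push_cast; ring
  -- Lemma 5.1 (lower half): `Φ_n^{s+2} ≥ e^{(s+2)n/4}` for large `n`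
  have hphi : ∀ᶠ n : ℕ in atTop, Real.exp (((s + 2 : ℕ) : ℝ) * n / 4) ≤ (PhiL n : ℝ) ^ (s + 2) :=
    eventually_exp_mul_le_PhiL_pow (s + 2)
  have hpnt' := tendsto_mersenne.eventually hpnt
  have hphi' := tendsto_mersenne.eventually hphi
  have hmaj := (tendsto_poly_expA s).comp tendsto_mersenne
  refine squeeze_zero' (Eventually.of_forall fun m => boundFunA_nonneg s m) ?_ hmaj
  filter_upwards [hpnt', hphi', eventually_ge_atTop 1] with m hd hP hm
  simp only [Function.comp_def]
  set n : ℕ := 2 ^ m - 1 with hn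
  have hn1 : ((n : ℝ) + 1) = (2 : ℝ) ^ m := by
    rw [hn, Nat.cast_sub Nat.one_le_two_pow]; push_cast; ring
  have hK : (0 : ℝ) ≤ (Krho s : ℝ) := Krho_cast_nonneg s
  -- `d_n^{3s+5}/Φ_n^{s+2} ≤ e^{(3s+5+¼)n}·e^{−(s+2)n/4}`
  have hdP : (Nat.lcmUpto n : ℝ) ^ (3 * s + 5) / (PhiL n : ℝ) ^ (s + 2) ≤
      Real.exp ((3 * s + 5 + 1 / 4) * n) * Real.exp (-(((s + 2 : ℕ) : ℝ) * n / 4)) := by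
    rw [Real.exp_neg, ← div_eq_mul_inv]
    exact div_le_div₀ (by positivity) hd (Real.exp_pos _) hP
  -- `2^{(2s+3)m − (10s+20)n − 5s − 8} ≤ (n+1)^{2s+3}·2^{−(10s+20)n}`
  have hz : (2 : ℝ) ^ ((2 * s + 3) * (m : ℤ) - (10 * s + 20) * (n : ℤ) - 5 * s - 8) ≤
      ((n : ℝ) + 1) ^ (2 * s + 3) * (2 : ℝ) ^ (-(((10 * s + 20) * n : ℕ) : ℤ)) := by
    rw [hn1, ← pow_mul, ← zpow_natCast (2 : ℝ) (m * (2 * s + 3)), ← zpow_add₀ two_ne_zero]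
    exact zpow_le_zpow_right₀ (by norm_num) (by push_cast; nlinarith)
  unfold boundFunA
  calc (Nat.lcmUpto n : ℝ) ^ (3 * s + 5) / (PhiL n : ℝ) ^ (s + 2) *
        ((Krho s : ℝ) * ((n : ℝ) + 1) ^ (2 * s + 6) * (2 : ℝ) ^ ((6 * s + 12) * n)) *
        (2 : ℝ) ^ ((2 * s + 3) * (m : ℤ) - (10 * s + 20) * (n : ℤ) - 5 * s - 8)
      ≤ (Real.exp ((3 * s + 5 + 1 / 4) * n) * Real.exp (-(((s + 2 : ℕ) : ℝ) * n / 4))) *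
        ((Krho s : ℝ) * ((n : ℝ) + 1) ^ (2 * s + 6) * (2 : ℝ) ^ ((6 * s + 12) * n)) *
        (((n : ℝ) + 1) ^ (2 * s + 3) * (2 : ℝ) ^ (-(((10 * s + 20) * n : ℕ) : ℤ))) := by
        gcongr
    _ = (Krho s : ℝ) * ((n : ℝ) + 1) ^ (4 * s + 9) *
        (Real.exp ((3 * s + 5 + 1 / 4) * n) * Real.exp (-(((s + 2 : ℕ) : ℝ) * n / 4)) *
          (2 : ℝ) ^ ((6 * s + 12) * n) * (2 : ℝ) ^ (-(((10 * s + 20) * n : ℕ) : ℤ))) := by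
        ring
    _ ≤ (Krho s : ℝ) * ((n : ℝ) + 1) ^ (4 * s + 9) * Real.exp (-(n : ℝ) / 2) :=
        mul_le_mul_of_nonneg_left (exp_mul_two_pow_leA s n) (by positivity)

/-- Each product `|coef_o|·‖form‖₂` is at most `boundFunA s m` (`n = 2^m − 1`, `m ≥ 2`, `δ ≤ 1`).
[cite: Lai2025TwoAdicZeta, §7 (proof of Thm 1.2, the displayed estimate)] -/
theorem abs_mul_norm_le_boundFunA (s : ℕ) {δ : ℕ} (hδ : δ ≤ 1) {m : ℕ} (hm : 2 ≤ m) (o : Option (parIdx s δ)) :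
    |((coefVecA s δ (2 ^ m - 1) o : ℚ) : ℝ)| * ‖∑ o', ((coefVecA s δ (2 ^ m - 1) o' : ℚ) : ℚ_[2]) * xiVecA s δ o'‖ ≤
      boundFunA s m := by
  unfold boundFunA
  have hK := Krho_cast_nonneg s
  exact mul_le_mul (abs_coefVecA_le s hδ (2 ^ m - 1) o) (norm_linearFormA_mersenne_le s hδ hm) (norm_nonneg _)
    (mul_nonneg (by positivity) (mul_nonneg (mul_nonneg hK (by positivity)) (by positivity)))

/-! ## §3. Theorem 1.2 and Theorem 1.1 -/

/-- **Theorem 1.2** (general `s`, as proved in §7): for `δ ≤ 1`, some `ζ₂(i+s+1, ¼)` with `i ∈ [2, 2s+4]`, `i ≡ δ (mod 2)`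
(i.e. `j = i+s+1 ∈ [s+3, 3s+5]`, `j ≡ s+1+δ`), is irrational — Lemma 2.1 (tree `exists_isIrrational_of_linearForms`)
applied to the integer forms `Φ_n^{−s−2}d_n^{3s+5}S_n`, `n = 2^m − 1`; the component `1` of the vector is rational, so the
irrational one is a `ζ₂(i+s+1,¼)`. [cite: Lai2025TwoAdicZeta, Thm 1.2 and §7 (its proof)] -/
theorem exists_isIrrational_parity_window (s δ : ℕ) (hδ : δ ≤ 1) :
    ∃ i : parIdx s δ, IsIrrational 2 (padicHurwitzZeta 2 ((i : ℕ) + s + 1) (4 : ℚ_[2])⁻¹) := by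
  classical
  have h := exists_isIrrational_of_linearForms (p := 2) (xiVecA s δ) fun ε hε => by
    obtain ⟨m, hm, hm2⟩ :=
      (((tendsto_boundFunA s).eventually (gt_mem_nhds hε)).and (eventually_ge_atTop 2)).exists
    have hint : ∀ o : Option (parIdx s δ), ∃ z : ℤ, coefVecA s δ (2 ^ m - 1) o = z :=
      fun o => exists_int_coefVecA s hδ (2 ^ m - 1) o
    choose z hz using hint
    have e : ∑ o, ((z o : ℤ) : ℚ_[2]) * xiVecA s δ o =
        ∑ o, ((coefVecA s δ (2 ^ m - 1) o : ℚ) : ℚ_[2]) * xiVecA s δ o :=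
      Fintype.sum_congr _ _ fun o => by rw [hz o]; push_cast; rfl
    refine ⟨z, ?_, fun o => ?_⟩
    · rw [e]; exact linearFormA_mersenne_ne_zero s hδ hm2
    · rw [e]
      have habs : (|z o| : ℝ) = |((coefVecA s δ (2 ^ m - 1) o : ℚ) : ℝ)| := by
        rw [hz o]; push_cast; rfl
      rw [habs]
      exact (abs_mul_norm_le_boundFunA s hδ hm2 o).trans_lt hm
  obtain ⟨o, ho⟩ := h
  cases o with
  | none =>
    exfalso
    have : ¬ IsIrrational 2 (((1 : ℚ)) : ℚ_[2]) := not_isIrrational_ratCast (p := 2) 1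
    exact this (by simpa [xiVecA] using ho)
  | some i => exact ⟨i, ho⟩

end Literature.NumberTheory.Irrationality.Lai2025TwoAdic

namespace Literature.NumberTheory.Irrationality.PAdicZetaValues

open Literature.NumberTheory.Irrationality.Lai2025TwoAdic

/-- **Lai 2025 (2-adic), Theorem 1.2, PROVED** — discharge of the named fact `lai2025TwoAdic_theorem12`: «For any
nonnegative integer `s` and any `δ ∈ {0,1}`, the following set contains at least one irrational number:
`{ζ₂(j, ¼) | j ∈ ℤ ∩ [s+3, 3s+5], j ≡ δ (mod 2)}`» (`ζ₂(j,¼)` = the tree's `padicHurwitzZeta 2 j 4⁻¹`), along the printed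
proof (§§3–7 for the family `A_n` with parity parameter `δ' ≡ δ + s + 1`: the linear forms `S_n = ∫_{ℤ₂}A_n^{(s)}(t+¼)dt`,
their arithmetic incl. the factor `Φ_n`, Archimedean and `2`-adic sizes, and Lemma 2.1).
[cite: Lai2025TwoAdicZeta, Thm 1.2 (§1) and §7 (proof)] -/
theorem lai2025TwoAdic_theorem12_holds : lai2025TwoAdic_theorem12 := by
  intro s δ hδ
  obtain ⟨i, hi⟩ := exists_isIrrational_parity_window s ((δ + s + 1) % 2) (by omega)
  have hi2 := mem_parIdx.1 i.2
  exact ⟨(i : ℕ) + s + 1, by omega, by omega, by omega, hi⟩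

/-- **Lai 2025 (2-adic), Theorem 1.1, PROVED** — discharge of the named fact `lai2025TwoAdic_theorem11`: «For every
nonnegative integer `s`, the following set contains at least one irrational number: `{ζ₂(j) | j ∈ ℤ ∩ [s+3, 3s+5], j odd}`»
(`ζ₂(j)` = the tree's `padicZetaValue 2 j`) — «By Lemma 2.7, Theorem 1.1 is the special case `δ = 1` of Theorem 1.2»:
`ζ₂(j) = ½ζ₂(j,¼)` (`lai2025TwoAdic_lemma27_two_holds`) and a nonzero rational multiple of an irrational number is irrational.
[cite: Lai2025TwoAdicZeta, Thm 1.1 (§1) and §7 (proof)] -/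
theorem lai2025TwoAdic_theorem11_holds : lai2025TwoAdic_theorem11 := by
  intro s
  obtain ⟨j, hj1, hj2, hj3, hj⟩ := lai2025TwoAdic_theorem12_holds s 1 le_rfl
  have hodd : Odd j := Nat.odd_iff.2 hj3
  refine ⟨j, hodd, hj1, hj2, ?_⟩
  rw [lai2025TwoAdic_lemma27_two_holds j hodd (by omega)]
  refine (isIrrational_iff (p := 2) _).2 fun q hq => (isIrrational_iff (p := 2) _).1 hj (2 * q) ?_
  push_cast
  rw [hq]
  ring

/-- **Theorem 1.1, the case `s = 3`** («In particular, at least one of the four `2`-adic numbers `ζ₂(7), ζ₂(9), ζ₂(11),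
ζ₂(13)` is irrational»). [cite: Lai2025TwoAdicZeta, Thm 1.1 (§1) and §7 ("Taking s = 3 …")] -/
theorem exists_isIrrational_padicZetaValue_two_seven_to_thirteen :
    ∃ j ∈ ({7, 9, 11, 13} : Finset ℕ), IsIrrational 2 (padicZetaValue 2 j) := by
  obtain ⟨j, hodd, h1, h2, hj⟩ := lai2025TwoAdic_theorem11_holds 3
  refine ⟨j, ?_, hj⟩
  obtain ⟨k, rfl⟩ := hodd
  simp only [Finset.mem_insert, Finset.mem_singleton]
  omega

end Literature.NumberTheory.Irrationality.PAdicZetaValues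

end
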